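import Literature.Analysis.InverseSpectral.KreinStringProofs
import HarnessLib

/-!
# Kreĭn strings: integration by parts and the Lagrange (Wronskian) identity

Derivative-free calculus for the fundamental system `φ(·, z)`, `ψ(·, z)` of a Kreĭn string
(`KreinString.phi`, `KreinString.psi`). Writing `Φ(t) = ∫_{[0,t]} φ dm`, `Ψ(t) = ∫_{[0,t]} ψ dm`,
the right derivatives of `φ`, `ψ` are `φ⁺' = -z Φ`, `ψ⁺' = 1 - z Ψ`, and:

* `integral_mul_integral_eq_parts`: integration by parts in product form,
  `(∫₀ˣ a)(∫_{[0,x]} b dν) = ∫_{[0,x]} b(u) (∫₀ᵘ a) dν(u) + ∫₀ˣ a(t) (∫_{[0,t]} b dν) dt`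
  for `a ∈ L¹(dt)`, `b ∈ L¹(ν)` on `[0, x]` — Fubini on `[0,x]²` split along `{u ≤ t}`; no atom
  correction appears because `t ↦ ∫₀ᵗ a` is continuous;
* `integral_sub_mul_eq_integral_integral`: `∫_{[0,x]} (x - u) g dν = ∫₀ˣ (∫_{[0,t]} g dν) dt`;
* `phi_eq_one_sub_integral`, `psi_eq_sub_integral`: `φ(x) = 1 - z ∫₀ˣ Φ`, `ψ(x) = x - z ∫₀ˣ Ψ`
  (i.e. `φ = 1 + ∫ φ⁺'`, `ψ = ∫ ψ⁺'`);
* `wronskian_phi_psi`: the Lagrange identity `φ ψ⁺' - φ⁺' ψ ≡ 1` on `[0, L)`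
  (Kac–Kreĭn 1974 §1, the identity behind `ψ/φ = ∫ φ⁻²`, Tomisaki 1988 (4.1)).

## References

KacKrein1974 (§1), Tomisaki1988 (§4), DymMcKean1976 (Ch. 5).
-/

open MeasureTheory Filter Set Topology
open scoped ENNReal Nat

noncomputable section

namespace Literature.Analysis.InverseSpectral

/-- **Integration by parts in product form.** For `a` Lebesgue-integrable and `b` `ν`-integrable on
`[0, x]` (`ν([0,x]) < ∞`):
`(∫_{[0,x]} a dt)(∫_{[0,x]} b dν)`
`  = ∫_{[0,x]} b(u) (∫_{[0,u]} a dt) dν(u) + ∫_{[0,x]} a(t) (∫_{[0,t]} b dν) dt`,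
i.e. `A(x) B(x) = ∫ A dB + ∫ B dA` for `A(t) = ∫₀ᵗ a`, `B(t) = ∫_{[0,t]} b dν`. Proof: Fubini on
`[0,x]²`, split along `{(u,t) : u ≤ t}`. [folklore] -/
theorem integral_mul_integral_eq_parts {x : ℝ} {ν : Measure ℝ} (hν : ν (Icc 0 x) ≠ ⊤)
    {a b : ℝ → ℂ} (ha : IntegrableOn a (Icc 0 x)) (hb : IntegrableOn b (Icc 0 x) ν) :
    (∫ t in Icc 0 x, a t) * (∫ u in Icc 0 x, b u ∂ν) =
      (∫ u in Icc 0 x, b u * (∫ t in Icc 0 u, a t) ∂ν) +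
        ∫ t in Icc 0 x, a t * (∫ u in Icc 0 t, b u ∂ν) := by
  haveI : IsFiniteMeasure (ν.restrict (Icc 0 x)) := isFiniteMeasure_restrict.2 hν
  haveI : IsFiniteMeasure ((volume : Measure ℝ).restrict (Icc 0 x)) :=
    isFiniteMeasure_restrict.2 measure_Icc_lt_top.ne
  set F : ℝ × ℝ → ℂ := fun p => b p.1 * a p.2 with hF
  have hFi : Integrable F ((ν.restrict (Icc 0 x)).prod (volume.restrict (Icc 0 x))) :=
    hb.mul_prod ha
  set D : Set (ℝ × ℝ) := {p | p.1 ≤ p.2} with hD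
  have hDm : MeasurableSet D := measurableSet_le measurable_fst measurable_snd
  -- Step 1: the product of the integrals is the double integral of `F`.
  have h1 : (∫ t in Icc 0 x, a t) * (∫ u in Icc 0 x, b u ∂ν) =
      ∫ p, F p ∂(ν.restrict (Icc 0 x)).prod (volume.restrict (Icc 0 x)) := by
    rw [integral_prod F hFi]
    simp only [hF]
    simp_rw [integral_const_mul]
    rw [integral_mul_const, mul_comm]
  -- Step 2: split along `D`.
  have h2 : ∫ p, F p ∂(ν.restrict (Icc 0 x)).prod (volume.restrict (Icc 0 x)) =
      (∫ p, Dᶜ.indicator F p ∂(ν.restrict (Icc 0 x)).prod (volume.restrict (Icc 0 x))) +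
        ∫ p, D.indicator F p ∂(ν.restrict (Icc 0 x)).prod (volume.restrict (Icc 0 x)) := by
    rw [← integral_add (hFi.indicator hDm.compl) (hFi.indicator hDm)]
    simp only [Set.indicator_compl_add_self_apply]
  -- Step 3: the part `t < u` (no swap needed).
  have h3 : ∫ p, Dᶜ.indicator F p ∂(ν.restrict (Icc 0 x)).prod (volume.restrict (Icc 0 x)) =
      ∫ u in Icc 0 x, b u * (∫ t in Icc 0 u, a t) ∂ν := by
    rw [integral_prod _ (hFi.indicator hDm.compl)]
    refine setIntegral_congr_fun measurableSet_Icc (fun u hu => ?_)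
    have hind : (fun t => Dᶜ.indicator F (u, t)) = (Iio u).indicator (fun t => b u * a t) := by
      ext t
      simp only [hD, hF, Set.indicator, Set.mem_compl_iff, Set.mem_setOf_eq, not_le, Set.mem_Iio]
    have hset : Iio u ∩ Icc 0 x = Ico 0 u := by
      ext t
      simp only [mem_inter_iff, mem_Iio, mem_Icc, mem_Ico]
      constructor
      · rintro ⟨h1, h2, -⟩
        exact ⟨h2, h1⟩
      · rintro ⟨h1, h2⟩
        exact ⟨h2, h1, h2.le.trans hu.2⟩
    rw [hind, integral_indicator measurableSet_Iio, Measure.restrict_restrict measurableSet_Iio,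
      integral_const_mul, hset, integral_Icc_eq_integral_Ico]
  -- Step 4: the part `u ≤ t`, after swapping the order of integration.
  have h4 : ∫ p, D.indicator F p ∂(ν.restrict (Icc 0 x)).prod (volume.restrict (Icc 0 x)) =
      ∫ t in Icc 0 x, a t * (∫ u in Icc 0 t, b u ∂ν) := by
    rw [integral_prod_symm _ (hFi.indicator hDm)]
    refine setIntegral_congr_fun measurableSet_Icc (fun t ht => ?_)
    have hind : (fun u => D.indicator F (u, t)) = (Iic t).indicator (fun u => b u * a t) := by
      ext u
      simp only [hD, hF, Set.indicator, Set.mem_setOf_eq, Set.mem_Iic]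
    have hset : Iic t ∩ Icc 0 x = Icc 0 t := by
      ext u
      simp only [mem_inter_iff, mem_Iic, mem_Icc]
      constructor
      · rintro ⟨h1, h2, -⟩
        exact ⟨h2, h1⟩
      · rintro ⟨h1, h2⟩
        exact ⟨h2, h1, h2.trans ht.2⟩
    rw [hind, integral_indicator measurableSet_Iic, Measure.restrict_restrict measurableSet_Iic,
      integral_mul_const, mul_comm, hset]
  rw [h1, h2, h3, h4]

/-- The Lebesgue integral of `1` over `[0, u]` is `u` (as a complex number). [folklore] -/
lemma integral_Icc_one_eq {u : ℝ} (hu : 0 ≤ u) : ∫ _ in Icc 0 u, (1 : ℂ) = u := by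
  rw [setIntegral_const, Real.volume_real_Icc_of_le hu, sub_zero, Complex.real_smul, mul_one]

/-- `‖∫_{[0,t]} g dν‖ ≤ ∫_{[0,x]} ‖g‖ dν` for `t ∈ [0, x]`. [folklore] -/
lemma norm_setIntegral_Icc_le {x : ℝ} {ν : Measure ℝ} {g : ℝ → ℂ} (hg : IntegrableOn g (Icc 0 x) ν)
    {t : ℝ} (ht : t ∈ Icc 0 x) : ‖∫ u in Icc 0 t, g u ∂ν‖ ≤ ∫ u in Icc 0 x, ‖g u‖ ∂ν :=
  (norm_integral_le_integral_norm _).trans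
    (setIntegral_mono_set hg.norm (ae_of_all _ fun _ => norm_nonneg _)
      (Icc_subset_Icc_right ht.2).eventuallyLE)

/-- The primitive `t ↦ ∫_{[0,t]} g dν` of a `ν`-integrable `g` on `[0, x]` is Lebesgue-integrable on
`[0, x]` (it is bounded by `∫_{[0,x]} |g| dν` and measurable by Fubini). [folklore] -/
theorem integrableOn_integral_Icc {x : ℝ} {ν : Measure ℝ} (hν : ν (Icc 0 x) ≠ ⊤) {g : ℝ → ℂ}
    (hg : IntegrableOn g (Icc 0 x) ν) :
    IntegrableOn (fun t => ∫ u in Icc 0 t, g u ∂ν) (Icc 0 x) := by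
  haveI : IsFiniteMeasure (ν.restrict (Icc 0 x)) := isFiniteMeasure_restrict.2 hν
  haveI : IsFiniteMeasure ((volume : Measure ℝ).restrict (Icc 0 x)) :=
    isFiniteMeasure_restrict.2 measure_Icc_lt_top.ne
  set G : ℝ × ℝ → ℂ := fun p => ({p : ℝ × ℝ | p.2 ≤ p.1}).indicator (fun p => g p.2) p with hG
  have hGm : AEStronglyMeasurable G ((volume.restrict (Icc 0 x)).prod (ν.restrict (Icc 0 x))) :=
    (hg.aestronglyMeasurable.comp_snd).indicator (measurableSet_le measurable_snd measurable_fst)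
  have hmeas : AEStronglyMeasurable (fun t => ∫ u, G (t, u) ∂(ν.restrict (Icc 0 x)))
      (volume.restrict (Icc 0 x)) := hGm.integral_prod_right'
  have heq : ∀ t ∈ Icc 0 x, ∫ u, G (t, u) ∂(ν.restrict (Icc 0 x)) = ∫ u in Icc 0 t, g u ∂ν := by
    intro t ht
    have hind : (fun u => G (t, u)) = (Iic t).indicator g := by
      ext u
      simp only [hG, Set.indicator, Set.mem_setOf_eq, Set.mem_Iic]
    have hset : Iic t ∩ Icc 0 x = Icc 0 t := by
      ext u
      simp only [mem_inter_iff, mem_Iic, mem_Icc]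
      constructor
      · rintro ⟨h1, h2, -⟩
        exact ⟨h2, h1⟩
      · rintro ⟨h1, h2⟩
        exact ⟨h2, h1, h2.trans ht.2⟩
    rw [hind, integral_indicator measurableSet_Iic, Measure.restrict_restrict measurableSet_Iic,
      hset]
  refine Integrable.mono' (g := fun _ => ∫ u in Icc 0 x, ‖g u‖ ∂ν) (integrable_const _)
    (hmeas.congr ((ae_restrict_mem measurableSet_Icc).mono heq)) ?_
  exact ae_restrict_of_forall_mem measurableSet_Icc (fun t ht => norm_setIntegral_Icc_le hg ht)

/-- The Volterra–Stieltjes kernel as an iterated integral: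
`∫_{[0,x]} (x - u) g(u) dν(u) = ∫₀ˣ (∫_{[0,t]} g dν) dt` for `g` `ν`-integrable on `[0, x]`.
[folklore] -/
theorem integral_sub_mul_eq_integral_integral {x : ℝ} (hx : 0 ≤ x) {ν : Measure ℝ}
    (hν : ν (Icc 0 x) ≠ ⊤) {g : ℝ → ℂ} (hg : IntegrableOn g (Icc 0 x) ν) :
    ∫ u in Icc 0 x, ((x - u : ℝ) : ℂ) * g u ∂ν = ∫ t in Icc 0 x, (∫ u in Icc 0 t, g u ∂ν) := by
  haveI : IsFiniteMeasure (ν.restrict (Icc 0 x)) := isFiniteMeasure_restrict.2 hν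
  haveI : IsFiniteMeasure ((volume : Measure ℝ).restrict (Icc 0 x)) :=
    isFiniteMeasure_restrict.2 measure_Icc_lt_top.ne
  have h := integral_mul_integral_eq_parts hν (a := fun _ => (1 : ℂ)) (integrable_const _) hg
  rw [integral_Icc_one_eq hx] at h
  have hu : ∫ u in Icc 0 x, g u * (∫ _ in Icc 0 u, (1 : ℂ)) ∂ν =
      ∫ u : ℝ in Icc 0 x, (u : ℂ) * g u ∂ν := by
    refine setIntegral_congr_fun measurableSet_Icc (fun u hu => ?_)
    rw [integral_Icc_one_eq hu.1, mul_comm]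
  simp only [one_mul] at h
  rw [hu] at h
  have hint : IntegrableOn (fun u : ℝ => (u : ℂ) * g u) (Icc 0 x) ν :=
    hg.continuousOn_mul (Complex.continuous_ofReal.continuousOn) isCompact_Icc
  calc ∫ u in Icc 0 x, ((x - u : ℝ) : ℂ) * g u ∂ν
      = ∫ u in Icc 0 x, ((x : ℂ) * g u - (u : ℂ) * g u) ∂ν := by
        refine setIntegral_congr_fun measurableSet_Icc (fun u _ => ?_)
        push_cast
        ring
    _ = (x : ℂ) * (∫ u in Icc 0 x, g u ∂ν) - ∫ u : ℝ in Icc 0 x, (u : ℂ) * g u ∂ν := by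
        rw [integral_sub (hg.const_mul _) hint, integral_const_mul]
    _ = ∫ t in Icc 0 x, (∫ u in Icc 0 t, g u ∂ν) := by
        rw [h]; ring

namespace KreinString

variable (S : KreinString)

/-- `φ(x, z) = 1 - z ∫₀ˣ Φ(t) dt` with `Φ(t) = ∫_{[0,t]} φ(·, z) dm`; equivalently `φ = 1 + ∫₀ˣ φ⁺'`
with the right derivative `φ⁺' = -z Φ`. [folklore] -/
theorem phi_eq_one_sub_integral (z : ℂ) {x : ℝ} (hx : x ∈ S.dom) :
    S.phi z x = 1 - z * ∫ t in Icc 0 x, (∫ u in Icc 0 t, S.phi z u ∂S.massMeasure) := by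
  have h := (S.isSolution_phi z).2 x hx
  rw [integral_sub_mul_eq_integral_integral hx.1 (S.massMeasure_Icc_lt_top hx).ne
    (S.integrableOn_Icc_of_continuousOn hx ((S.isSolution_phi z).1.mono (S.Icc_subset_dom hx)))]
    at h
  simpa using h

/-- `ψ(x, z) = x - z ∫₀ˣ Ψ(t) dt` with `Ψ(t) = ∫_{[0,t]} ψ(·, z) dm`; equivalently `ψ = ∫₀ˣ ψ⁺'`
with the right derivative `ψ⁺' = 1 - z Ψ`. [folklore] -/
theorem psi_eq_sub_integral (z : ℂ) {x : ℝ} (hx : x ∈ S.dom) :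
    S.psi z x = x - z * ∫ t in Icc 0 x, (∫ u in Icc 0 t, S.psi z u ∂S.massMeasure) := by
  have h := (S.isSolution_psi z).2 x hx
  rw [integral_sub_mul_eq_integral_integral hx.1 (S.massMeasure_Icc_lt_top hx).ne
    (S.integrableOn_Icc_of_continuousOn hx ((S.isSolution_psi z).1.mono (S.Icc_subset_dom hx)))]
    at h
  simpa using h

/-- **Lagrange identity (Wronskian) for the fundamental system.** With the right derivatives
`φ⁺'(x) = -z ∫_{[0,x]} φ dm` and `ψ⁺'(x) = 1 - z ∫_{[0,x]} ψ dm`,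
`φ(x) ψ⁺'(x) - φ⁺'(x) ψ(x) = 1` for every `x ∈ [0, L)`. Proof: two integrations by parts
(`integral_mul_integral_eq_parts`) and `φ = 1 - z ∫ Φ`. [cite: KacKrein1974, §1] -/
theorem wronskian_phi_psi (z : ℂ) {x : ℝ} (hx : x ∈ S.dom) :
    S.phi z x * (1 - z * ∫ u in Icc 0 x, S.psi z u ∂S.massMeasure) -
      (-z * ∫ u in Icc 0 x, S.phi z u ∂S.massMeasure) * S.psi z x = 1 := by
  obtain ⟨Φ, hΦ⟩ : ∃ Φ : ℝ → ℂ, Φ = fun t => ∫ u in Icc 0 t, S.phi z u ∂S.massMeasure := ⟨_, rfl⟩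
  obtain ⟨Ψ, hΨ⟩ : ∃ Ψ : ℝ → ℂ, Ψ = fun t => ∫ u in Icc 0 t, S.psi z u ∂S.massMeasure := ⟨_, rfl⟩
  have hΦt : ∀ t, ∫ u in Icc 0 t, S.phi z u ∂S.massMeasure = Φ t := fun t => by rw [hΦ]
  have hΨt : ∀ t, ∫ u in Icc 0 t, S.psi z u ∂S.massMeasure = Ψ t := fun t => by rw [hΨ]
  rw [hΦt, hΨt]
  -- integrability of everything in sight on `[0, x]`
  have hμx : S.massMeasure (Icc 0 x) ≠ ⊤ := (S.massMeasure_Icc_lt_top hx).ne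
  haveI : IsFiniteMeasure (S.massMeasure.restrict (Icc 0 x)) := isFiniteMeasure_restrict.2 hμx
  haveI : IsFiniteMeasure ((volume : Measure ℝ).restrict (Icc 0 x)) :=
    isFiniteMeasure_restrict.2 measure_Icc_lt_top.ne
  have hφc : ContinuousOn (S.phi z) (Icc 0 x) := (S.isSolution_phi z).1.mono (S.Icc_subset_dom hx)
  have hψc : ContinuousOn (S.psi z) (Icc 0 x) := (S.isSolution_psi z).1.mono (S.Icc_subset_dom hx)
  have hφi : IntegrableOn (S.phi z) (Icc 0 x) S.massMeasure :=
    S.integrableOn_Icc_of_continuousOn hx hφc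
  have hψi : IntegrableOn (S.psi z) (Icc 0 x) S.massMeasure :=
    S.integrableOn_Icc_of_continuousOn hx hψc
  have hφψi : IntegrableOn (fun u => S.phi z u * S.psi z u) (Icc 0 x) S.massMeasure :=
    S.integrableOn_Icc_of_continuousOn hx (hφc.mul hψc)
  have hΦi : IntegrableOn Φ (Icc 0 x) := by rw [hΦ]; exact integrableOn_integral_Icc hμx hφi
  have hΨi : IntegrableOn Ψ (Icc 0 x) := by rw [hΨ]; exact integrableOn_integral_Icc hμx hψi
  have hΦb : ∀ t ∈ Icc 0 x, ‖Φ t‖ ≤ ∫ u in Icc 0 x, ‖S.phi z u‖ ∂S.massMeasure := fun t ht => by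
    rw [← hΦt]; exact norm_setIntegral_Icc_le hφi ht
  have hΦΨi : IntegrableOn (fun t => Φ t * Ψ t) (Icc 0 x) :=
    Integrable.bdd_mul hΨi hΦi.aestronglyMeasurable
      (ae_restrict_of_forall_mem measurableSet_Icc hΦb)
  -- FTC forms `φ = 1 - z ∫ Φ`, `ψ = t - z ∫ Ψ` at every point of `[0, x]`
  have hφ_eq : ∀ t ∈ Icc 0 x, S.phi z t = 1 - z * ∫ s in Icc 0 t, Φ s := fun t ht => by
    have h := S.phi_eq_one_sub_integral z (S.Icc_subset_dom hx ht)
    simp only [hΦt] at h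
    exact h
  have hψ_eq : ∀ t ∈ Icc 0 x, S.psi z t = t - z * ∫ s in Icc 0 t, Ψ s := fun t ht => by
    have h := S.psi_eq_sub_integral z (S.Icc_subset_dom hx ht)
    simp only [hΨt] at h
    exact h
  have ha1 : ∀ t ∈ Icc 0 x, ∫ s in Icc 0 t, -z * Φ s = S.phi z t - 1 := fun t ht => by
    rw [integral_const_mul, hφ_eq t ht]; ring
  have ha2 : ∀ t ∈ Icc 0 x, ∫ s in Icc 0 t, (1 - z * Ψ s) = S.psi z t := fun t ht => by
    haveI : IsFiniteMeasure ((volume : Measure ℝ).restrict (Icc 0 t)) :=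
      isFiniteMeasure_restrict.2 measure_Icc_lt_top.ne
    rw [integral_sub (integrable_const _) ((hΨi.mono_set (Icc_subset_Icc_right ht.2)).const_mul z),
      integral_const_mul, integral_Icc_one_eq ht.1, hψ_eq t ht]
  -- by parts 1: `a = φ⁺' = -z Φ`, `b = ψ`, giving `φ(x) Ψ(x) = ∫ φ ψ dm + ∫ φ⁺' Ψ dt`
  have hq1 : ∫ u in Icc 0 x, S.psi z u * (∫ t in Icc 0 u, -z * Φ t) ∂S.massMeasure =
      (∫ u in Icc 0 x, S.phi z u * S.psi z u ∂S.massMeasure) - Ψ x := by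
    rw [← hΨt, ← integral_sub hφψi hψi]
    refine setIntegral_congr_fun measurableSet_Icc (fun u hu => ?_)
    rw [ha1 u hu]; ring
  have E1 : S.phi z x * Ψ x = (∫ u in Icc 0 x, S.phi z u * S.psi z u ∂S.massMeasure) +
      ∫ t in Icc 0 x, (-z * Φ t) * Ψ t := by
    have h := integral_mul_integral_eq_parts hμx (hΦi.const_mul (-z)) hψi
    simp only [hΨt] at h
    rw [ha1 x ⟨hx.1, le_rfl⟩, hq1] at h
    linear_combination h
  -- by parts 2: `a = ψ⁺' = 1 - z Ψ`, `b = φ`, giving `ψ(x) Φ(x) = ∫ φ ψ dm + ∫ ψ⁺' Φ dt`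
  have hq2 : ∫ u in Icc 0 x, S.phi z u * (∫ t in Icc 0 u, (1 - z * Ψ t)) ∂S.massMeasure =
      ∫ u in Icc 0 x, S.phi z u * S.psi z u ∂S.massMeasure := by
    refine setIntegral_congr_fun measurableSet_Icc (fun u hu => ?_)
    rw [ha2 u hu]
  have E2 : S.psi z x * Φ x = (∫ u in Icc 0 x, S.phi z u * S.psi z u ∂S.massMeasure) +
      ∫ t in Icc 0 x, (1 - z * Ψ t) * Φ t := by
    have h := integral_mul_integral_eq_parts hμx (a := fun t => (1 : ℂ) - z * Ψ t)
      (by exact (integrable_const _).sub (hΨi.const_mul z)) hφi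
    simp only [hΦt] at h
    rw [ha2 x ⟨hx.1, le_rfl⟩, hq2] at h
    exact h
  have E3 : ∫ t in Icc 0 x, (-z * Φ t) * Ψ t = -z * ∫ t in Icc 0 x, Φ t * Ψ t := by
    rw [← integral_const_mul]
    exact integral_congr_ae (ae_of_all _ fun t => by ring)
  have E4 : ∫ t in Icc 0 x, (1 - z * Ψ t) * Φ t =
      (∫ t in Icc 0 x, Φ t) - z * ∫ t in Icc 0 x, Φ t * Ψ t := by
    rw [← integral_const_mul, ← integral_sub hΦi (hΦΨi.const_mul z)]
    exact integral_congr_ae (ae_of_all _ fun t => by ring)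
  have E5 : S.phi z x = 1 - z * ∫ t in Icc 0 x, Φ t := hφ_eq x ⟨hx.1, le_rfl⟩
  linear_combination E5 - z * E1 + z * E2 - z * E3 + z * E4

end KreinString

end Literature.Analysis.InverseSpectral

end
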